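import Mathlib.Analysis.InnerProductSpace.PiL2
import Mathlib.MeasureTheory.Measure.Haar.InnerProductSpace
import Mathlib.Analysis.Calculus.ContDiff.Operations
import Mathlib.Topology.MetricSpace.Holder
import Mathlib.Dynamics.Ergodic.MeasurePreserving
import Mathlib.MeasureTheory.Measure.Prod
import Mathlib.MeasureTheory.Integral.Bochner.Basic
import Mathlib.Analysis.SpecialFunctions.Exp
import HarnessLib

/-!
# Anosov dice: the rotor–die interface of route `AnosovRotorDice`

Topic `Literature/Dynamics/Hyperbolic` (definition item `defn-AnosovDie`, request D1 of route
`Summits/AtomisticToContinuum/HydrodynamicLimit/Theses/AnosovRotorDice.lean`; consumers: cruxes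
`OneSphereHopfToMaxwellian` (stmt-5118), `RotorDiceHopf` (stmt-5239), support `DiceConstruction`
(stmt-5377), and the forthcoming `DicedHardSphereFlow` (D2)).

An **Anosov die** is the datum read by two colliding "rotor spheres" to decide their outgoing
relative direction: a measure-preserving, time-reversible, exponentially mixing measurable flow
`g` on a compact metric probability space `(K, m)` (the ROTOR; intended instance: the geodesic
flow of a closed hyperbolic surface on `K = T¹M = Γ\PSL(2,ℝ)` run at speed `Ω`, Liouville = Haar
measure, flip `ι`), equipped with a uniformly expanded family of UNSTABLE PLAQUES (intended:
the expanding horocycle flow `h`, `g_t ∘ h_r = h_{e^{Ωt} r} ∘ g_t`), and a DIE MAP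
`F : K × K → (area-preserving smooth self-maps of the closed unit disc)` acting on the LAMBERT DISC
of the outgoing hemisphere at a contact.  This file is an INTERFACE (a hypothesis structure in
the style of `Literature.Analysis.FluidPDE.HardSphereFlow`): it bundles data and axioms and
asserts NO existence — the existence of a non-trivial instance is the route's separate support
statement `DiceConstruction`; all signatures downstream read `∀ D : AnosovDie, …`.

## The collision rule the interface is made for (fixed here so that D2 and the die agree)

At a contact of spheres `i, j` with unit normal `ω` and incoming relative velocity `g`
(`g · ω < 0`) the pair keeps its centre-of-mass velocity and `|g|` and leaves with
`ĝ′ = Λ_ω⁻¹ (F(θ_i, θ_j) (Λ_ω (S_ω ĝ)))`, where `S_ω g = g − 2 (g·ω) ω` is the specular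
reflection and `Λ_ω : {n ∈ S² | n·ω > 0} → {p ∈ ω^⊥ | |p| < 1}`, `Λ_ω n = n − (n·ω) ω`, is
Lambert's (orthogonal) projection of the outgoing hemisphere onto the unit disc of `ω^⊥`.
`Λ_ω` pushes the flux measure `(n·ω) dn` to Lebesgue measure on the disc, so
"`F(θ,θ′)` area-preserving on the disc" = "flux-preserving on the hemisphere", which is what makes
`Liouville ⊗ m^⊗N` invariant for the diced flow.  `F ≡ id` is the ordinary hard-sphere gas.

**Reversibility constant.** Velocity reversal composed with the rule must reproduce the rule with
rotors `ι θ`: the reversed collision has incoming `−ĝ′` and must exit along `−ĝ`.  Since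
`Λ_ω (−S_ω n) = −n + (n·ω) ω = −Λ_ω n` for `n` in the outgoing hemisphere, in Lambert coordinates
both `n ↦ −S_ω n` read as the point reflection `C p = −p`; hence the requirement is
`F(ιθ, ιθ′) (−F(θ,θ′) q) = −q`, i.e. `F(ιθ, ιθ′) = C ∘ F(θ,θ′)⁻¹ ∘ C` with `C = −id`
(field `die_rev`).  `C = −id` commutes with every linear frame `ℝ² ≅ ω^⊥`, so it is frame-free;
the die itself acts on the standard plane `EuclideanSpace ℝ (Fin 2)` (as requested) and D2
transports it to `ω^⊥` by a measurable orthonormal frame.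

## Design choices, and four points where the request (item `defn-AnosovDie`) was inconsistent

1. **Carrier bundled, universe `Type`.** `K : Type` is a field with instance fields (compact
   metric space, Borel σ-algebra, probability measure), so that `∀ D : AnosovDie, …` elaborates
   inside `def … : Prop` without universe annotations.
2. **Plaques as a global measurable `ℝ`-action** `plaque : K → ℝ → K` (`W θ r`), `W θ 0 = θ`,
   `W (W θ r) r′ = W θ (r + r′)`, continuous and injective in `r`, with the EXACT uniform
   covariance `g_t (W θ r) = W (g_t θ) (e^{λt} r)`, `λ = rate > 0` (the request's "where defined"
   local version globalises along the action; the horocycle flow of a compact hyperbolic surface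
   has no periodic orbits, so injectivity holds there).  The local plaque is `r ∈ [-1, 1]`.
3. **Transverse absolute continuity** ("disintegration of `m` along plaques equivalent to arc
   length with densities bounded above and below") is rendered as BOUNDED QUASI-INVARIANCE of `m`
   under plaque translations `|r| ≤ 1` (field `exists_plaque_density_bound`): the two are
   equivalent in substance (Rokhlin disintegration in flow boxes), and the intended instance has
   `C = 1` (Haar is horocycle-invariant).  The interface carries no stable foliation, so
   "holonomy invariance" beyond plaque translations and the flow (`measurePreserving_flow`,
   `flow_plaque`) is not a separate axiom.
4. **Exponential mixing** is Liverani's Cor. 2.5 form for every Hölder exponent `α ∈ (0, 1]`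
   with sup-norm + Hölder-constant bounds (`expMixing`; Liverani 2004, Cor. 2.5, bib key
   `Liverani2004`; for constant curvature also Moore 1987, Thm 1.1).
5. **(inconsistency a)** Crux `OneSphereHopfToMaxwellian` quantifies over "ANY die of interface
   D1, INCLUDING `F ≡ id`", while D1 as requested also lists FULL SUPPORT and PAIR-PLAQUE
   SUBMERSIVITY, which `F ≡ id` violates (`not_hasAbsolutelyContinuousLaw_of_die_eq_refl`).
   Resolution: those two clauses are PREDICATES on an `AnosovDie` (`HasFullSupport`,
   `HasAbsolutelyContinuousLaw`, `IsPairPlaqueSubmersive`), to be taken as hypotheses by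
   `RotorDiceHopf` and as conclusions by `DiceConstruction`; the structure admits the trivial die.
6. **(inconsistency b)** "`F(θ,θ′)` equal to the identity on a NEIGHBOURHOOD of the unit circle"
   contradicts both clauses quantified over ALL `p` in the OPEN disc (each forces
   `supp (F(θ,θ′) − id)` to reach the circle for a.e. `(θ,θ′)`).  We keep the quantified clauses as
   printed and require only `F(θ,θ′) p = p` for `‖p‖ ≥ 1` (`die_apply_of_one_le`); with
   `contDiff_die_plaque` this makes `F(θ,θ′) − id` smooth and flat at the circle (grazing
   directions untouched to infinite order), which is all the collision law needs.
7. **(inconsistency c)** The two-sided FULL SUPPORT "law of `F(·,·)(p)` under `m ⊗ m` EQUIVALENT to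
   Lebesgue on the closed disc for every `p` in the open disc" (`HasFullSupport`, kept verbatim)
   cannot hold for any die jointly continuous in `(θ, θ′, p)` on the compact `K × K × D̄` that fixes
   the circle: by uniform continuity `F(θ,θ′)(p)` stays within `ε` of `p/‖p‖` once `1 − ‖p‖ < δ`,
   uniformly in `(θ,θ′)`, so the law misses most of the disc.  The one-sided clause
   `HasAbsolutelyContinuousLaw` (law `≪` Lebesgue, which is what the one-sphere Hopf property (H)
   consumes) is offered as the satisfiable variant; `HasFullSupport → HasAbsolutelyContinuousLaw`.
8. **(point d)** The request left the reversal involution `C` "to be fixed together with D2"; it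
   is forced to be `−id` by the rule above, and is fixed here.

Everything in the ROTOR part is satisfied (as exact algebraic identities plus Hopf's ergodicity
and exponential mixing) by `K = Γ\PSL(2,ℝ)` compact, `m` = Haar, `g_t = · a_{Ωt}`,
`W_r = · n⁻(r)`, `ι = · w`; the DIE fields are satisfied by `F ≡ Equiv.refl`.  Non-vacuity of the
predicates in item 5 for a smooth die is exactly `DiceConstruction` (a) and is NOT claimed here.
Mathlib has no Anosov flows, no horocycle flow on `Γ\PSL(2,ℝ)` as a measurable dynamical system
and no decay of correlations (`lean search 'Anosov|exponentialMixing'`: nothing), so nothing is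
re-defined.

## References

* C. Liverani, *On contact Anosov flows*, Ann. of Math. 159 (2004) 1275–1312, Thm 2.4, Cor. 2.5
  (exponential decay of correlations for Hölder observables, `C⁴` contact Anosov flows).
* C. C. Moore, *Exponential decay of correlation coefficients for geodesic flows*, in: Group
  representations, ergodic theory, operator algebras, and mathematical physics, MSRI Publ. 6
  (1987) 163–181, Thm 1.1 (constant curvature, Hölder exponent `> 1/2`).
* M. Brin, Ja. Pesin, *Partially hyperbolic dynamical systems*, Math. USSR-Izv. 8 (1974) 177–218
  (absolute continuity of the unstable foliation); K. Burns, A. Wilkinson, Ann. of Math. 171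
  (2010) 451–489 (Hopf argument); F. Ledrappier, L.-S. Young, Ann. of Math. 122 (1985) (measures
  absolutely continuous along unstable manifolds); L. Barreira, Ya. Pesin, *Introduction to
  smooth ergodic theory* (2nd ed., 2023), Ch. 1, 7–9 (Anosov flows, geodesic flows, absolute
  continuity).
-/

noncomputable section

open MeasureTheory Set Function Metric
open scoped NNReal ContDiff

namespace Literature.Dynamics.Hyperbolic

/-- The plane of the Lambert disc (local notation). -/
local notation "E²" => EuclideanSpace ℝ (Fin 2)

/-- **Anosov die** (interface D1 of route `AnosovRotorDice`): a ROTOR — a compact metric space `K`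
with its Borel σ-algebra and a probability measure `m`, a jointly measurable flow `flow` (`g`)
preserving `m`, ergodic, reversed by a measurable `m`-preserving involution `rev` (`ι`,
`ι ∘ g_t = g_{−t} ∘ ι`), a measurable family of unstable plaques `plaque` (`W`, an `ℝ`-action,
each orbit map continuous and injective) uniformly expanded at rate `rate` (`λ > 0`:
`g_t (W θ r) = W (g_t θ) (e^{λt} r)`), along which `m` is quasi-invariant with densities bounded
above and below, and exponential mixing of `(g, m)` for Hölder observables of every exponent —
together with a DIE MAP `die` (`F`): for all `θ θ′` a bijection of the plane equal to the identity
off the open unit disc (hence a bijection of the closed disc), jointly measurable, smooth in the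
disc variable jointly with the plaque parameters of both rotors, Lebesgue-measure preserving, and
reversible: `F(ιθ, ιθ′) = C ∘ F(θ,θ′)⁻¹ ∘ C` with `C p = −p`.  Existence of instances is NOT part
of the structure (support item `DiceConstruction`); FULL SUPPORT and PAIR-PLAQUE SUBMERSIVITY are
the predicates `AnosovDie.HasFullSupport` / `HasAbsolutelyContinuousLaw` /
`IsPairPlaqueSubmersive` below (the trivial die `F ≡ id` is an `AnosovDie`).  The axioms are the
standard ones of a reversible, ergodic, exponentially mixing Anosov flow with absolutely continuous
unstable conditionals (Brin–Pesin 1974; Burns–Wilkinson 2010; exponential mixing in the form of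
Liverani 2004, Cor. 2.5). [cite: Liverani2004, Cor. 2.5] -/
structure AnosovDie where
  /-- The rotor state space `K` (intended: `T¹M` of a closed hyperbolic surface). -/
  K : Type
  /-- `K` is a metric space … -/
  [instMetricSpace : MetricSpace K]
  /-- … which is compact … -/
  [instCompactSpace : CompactSpace K]
  /-- … and carries a σ-algebra … -/
  [instMeasurableSpace : MeasurableSpace K]
  /-- … which is the Borel σ-algebra. -/
  [instBorelSpace : BorelSpace K]
  /-- The rotor's invariant probability measure `m` (intended: normalised Liouville = Haar). -/
  m : Measure K
  /-- `m` is a probability measure. -/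
  [instIsProbabilityMeasure : IsProbabilityMeasure m]
  /-- The rotor flow `g : ℝ → K → K` (intended: geodesic flow at speed `Ω`). -/
  flow : ℝ → K → K
  /-- The flow is jointly measurable in `(t, θ)`. -/
  measurable_flow : Measurable fun p : ℝ × K => flow p.1 p.2
  /-- `g_0 = id`. -/
  flow_zero : ∀ θ, flow 0 θ = θ
  /-- Group property `g_{s+t} = g_s ∘ g_t`. -/
  flow_add : ∀ s t θ, flow (s + t) θ = flow s (flow t θ)
  /-- Each `g_t` preserves `m`. -/
  measurePreserving_flow : ∀ t, MeasurePreserving (flow t) m m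
  /-- `m` is ergodic for the flow: every measurable flow-invariant set is null or conull. -/
  ergodic_flow : ∀ s : Set K, MeasurableSet s → (∀ t, flow t ⁻¹' s = s) → m s = 0 ∨ m sᶜ = 0
  /-- The time-reversal involution `ι` (intended: the flip `(x, ξ) ↦ (x, −ξ)`). -/
  rev : K → K
  /-- `ι` is measurable. -/
  measurable_rev : Measurable rev
  /-- `ι` is an involution. -/
  rev_rev : ∀ θ, rev (rev θ) = θ
  /-- `ι` conjugates `g_t` to `g_{−t}`: `ι (g_t θ) = g_{−t} (ι θ)`. -/
  rev_flow : ∀ t θ, rev (flow t θ) = flow (-t) (rev θ)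
  /-- `ι` preserves `m`. -/
  measurePreserving_rev : MeasurePreserving rev m m
  /-- The uniform expansion rate `λ > 0` of the plaques (intended: `λ = Ω`). -/
  rate : ℝ
  /-- The rate is positive. -/
  rate_pos : 0 < rate
  /-- The unstable plaques `W θ r`: `r ↦ W θ r` parametrises the unstable curve through `θ`
  (intended: the expanding horocycle flow, `r` = hyperbolic arc length). -/
  plaque : K → ℝ → K
  /-- The plaque family is jointly measurable in `(θ, r)`. -/
  measurable_plaque : Measurable fun p : K × ℝ => plaque p.1 p.2
  /-- Each plaque is a (continuous) curve. -/
  continuous_plaque : ∀ θ, Continuous (plaque θ)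
  /-- The plaque through `θ` passes through `θ` at parameter `0`. -/
  plaque_zero : ∀ θ, plaque θ 0 = θ
  /-- Plaques are orbits of an `ℝ`-action: `W (W θ r) r′ = W θ (r + r′)`. -/
  plaque_add : ∀ θ r r', plaque θ (r + r') = plaque (plaque θ r) r'
  /-- Each plaque is an injective curve. -/
  plaque_injective : ∀ θ, Injective (plaque θ)
  /-- Uniform expansion (covariance): `g_t (W θ r) = W (g_t θ) (e^{λ t} r)`. -/
  flow_plaque : ∀ t θ r, flow t (plaque θ r) = plaque (flow t θ) (Real.exp (rate * t) * r)
  /-- Transverse absolute continuity: `m` is quasi-invariant under plaque translations of length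
  `≤ 1`, with Radon–Nikodym densities bounded above and below by a uniform constant (equivalently:
  the conditional measures of `m` along local plaques are equivalent to arc length `dr` with
  densities bounded above and below). -/
  exists_plaque_density_bound : ∃ C : ℝ≥0, ∀ r ∈ Icc (-1 : ℝ) 1,
    m.map (fun θ => plaque θ r) ≤ C • m ∧ m ≤ C • m.map (fun θ => plaque θ r)
  /-- Exponential mixing for Hölder observables (Liverani 2004, Cor. 2.5 form): for every exponent
  `α ∈ (0, 1]` there are `C` and `c > 0` such that for all `f, h : K → ℝ` bounded by `B_f, B_h` and
  `α`-Hölder with constants `H_f, H_h`, and all `t ≥ 0`,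
  `|∫ f · (h ∘ g_t) dm − ∫ f dm ∫ h dm| ≤ C e^{−ct} (B_f + H_f) (B_h + H_h)`. -/
  expMixing : ∀ α : ℝ≥0, 0 < α → α ≤ 1 → ∃ C c : ℝ, 0 < c ∧
    ∀ (f h : K → ℝ) (Bf Bh : ℝ) (Hf Hh : ℝ≥0), (∀ x, |f x| ≤ Bf) → (∀ x, |h x| ≤ Bh) →
      HolderWith Hf α f → HolderWith Hh α h → ∀ t : ℝ, 0 ≤ t →
        |∫ x, f x * h (flow t x) ∂m - (∫ x, f x ∂m) * ∫ x, h x ∂m|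
          ≤ C * Real.exp (-(c * t)) * (Bf + Hf) * (Bh + Hh)
  /-- The die map `F(θ, θ′)`, a bijection of the plane of the Lambert disc. -/
  die : K → K → (E² ≃ E²)
  /-- The die is jointly measurable in `(θ, θ′, p)`. -/
  measurable_die : Measurable fun x : K × K × E² => die x.1 x.2.1 x.2.2
  /-- Off the open unit disc the die is the identity (so it is a bijection of the closed disc onto
  itself fixing the unit circle pointwise: grazing directions are untouched). -/
  die_apply_of_one_le : ∀ θ θ' (p : E²), 1 ≤ ‖p‖ → die θ θ' p = p
  /-- The die is `C^∞` in the disc variable jointly with the plaque parameters of both rotors: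
  `(r, r′, p) ↦ F(W θ r, W θ′ r′)(p)` is smooth on `ℝ × ℝ × ℝ²`. -/
  contDiff_die_plaque : ∀ θ θ',
    ContDiff ℝ ∞ fun x : ℝ × ℝ × E² => die (plaque θ x.1) (plaque θ' x.2.1) x.2.2
  /-- Each `F(θ, θ′)` preserves Lebesgue measure (area on the Lambert disc = flux on the outgoing
  hemisphere). -/
  measurePreserving_die : ∀ θ θ', MeasurePreserving (die θ θ') volume volume
  /-- Reversibility: `F(ιθ, ιθ′) = C ∘ F(θ,θ′)⁻¹ ∘ C` with `C p = −p` the Lambert image of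
  `n ↦ −S_ω n` (velocity reversal). -/
  die_rev : ∀ θ θ' (p : E²), die (rev θ) (rev θ') p = -((die θ θ').symm (-p))

namespace AnosovDie

-- The bundled carrier's structure instances (projections of the fields above; they apply only to
-- the carrier `D.K` / the measure `D.m` of an `AnosovDie` and override no library instance).
attribute [instance] instMetricSpace instCompactSpace instMeasurableSpace instBorelSpace
  instIsProbabilityMeasure

variable (D : AnosovDie)

/-! ### Rotor API -/

/-- Each time-`t` map of the rotor flow is measurable. [folklore] -/
theorem measurable_flow_apply (t : ℝ) : Measurable (D.flow t) :=
  D.measurable_flow.comp (measurable_const.prodMk measurable_id)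

/-- `g_{−t}` inverts `g_t`. [folklore] -/
theorem flow_neg_flow (t : ℝ) (θ : D.K) : D.flow (-t) (D.flow t θ) = θ := by
  rw [← D.flow_add, neg_add_cancel, D.flow_zero]

/-- `g_t` inverts `g_{−t}`. [folklore] -/
theorem flow_flow_neg (t : ℝ) (θ : D.K) : D.flow t (D.flow (-t) θ) = θ := by
  rw [← D.flow_add, add_neg_cancel, D.flow_zero]

/-- `ι` is an involution (`Function.Involutive`). [folklore] -/
theorem rev_involutive : Involutive D.rev := D.rev_rev

/-- Each plaque-translation map `θ ↦ W θ r` is measurable. [folklore] -/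
theorem measurable_plaque_apply (r : ℝ) : Measurable fun θ => D.plaque θ r :=
  D.measurable_plaque.comp (measurable_id.prodMk measurable_const)

/-- Translating back along a plaque: `W (W θ r) (−r) = θ`. [folklore] -/
theorem plaque_plaque_neg (θ : D.K) (r : ℝ) : D.plaque (D.plaque θ r) (-r) = θ := by
  rw [← D.plaque_add, add_neg_cancel, D.plaque_zero]

/-- The flow maps the local plaque of `θ` into the plaque of `g_t θ`, stretching the parameter by
`e^{λt} ≥ 1` for `t ≥ 0` (uniform expansion, restated). [folklore] -/
theorem one_le_exp_rate_mul {t : ℝ} (ht : 0 ≤ t) : 1 ≤ Real.exp (D.rate * t) :=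
  Real.one_le_exp (mul_nonneg D.rate_pos.le ht)

/-! ### Die API -/

/-- Each die map `F(θ, θ′)` is measurable. [folklore] -/
theorem measurable_die_apply (θ θ' : D.K) : Measurable (D.die θ θ') :=
  D.measurable_die.comp (measurable_const.prodMk (measurable_const.prodMk measurable_id))

/-- The inverse die map is read off reversibility: `F(θ,θ′)⁻¹ p = −F(ιθ, ιθ′)(−p)`. [folklore] -/
theorem die_symm_apply (θ θ' : D.K) (p : E²) :
    (D.die θ θ').symm p = -(D.die (D.rev θ) (D.rev θ') (-p)) := by
  rw [Equiv.symm_apply_eq]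
  have h := D.die_rev (D.rev θ) (D.rev θ') (-(D.die (D.rev θ) (D.rev θ') (-p)))
  rw [D.rev_rev, D.rev_rev] at h
  rw [h, neg_neg, Equiv.symm_apply_apply, neg_neg]

/-- The inverse die maps are measurable. [folklore] -/
theorem measurable_die_symm (θ θ' : D.K) : Measurable (D.die θ θ').symm := by
  have : ((D.die θ θ').symm : E² → E²) = fun p => -(D.die (D.rev θ) (D.rev θ') (-p)) :=
    funext (D.die_symm_apply θ θ')
  rw [this]
  exact ((D.measurable_die_apply _ _).comp measurable_neg).neg

/-- Each die map is `C^∞` in the disc variable. [folklore] -/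
theorem contDiff_die (θ θ' : D.K) : ContDiff ℝ ∞ (D.die θ θ') := by
  have h0 : ContDiff ℝ ∞ fun p : E² => ((0 : ℝ), (0 : ℝ), p) :=
    contDiff_const.prodMk (contDiff_const.prodMk contDiff_id)
  have h := ContDiff.comp (D.contDiff_die_plaque θ θ') h0
  simpa [Function.comp_def, D.plaque_zero] using h

/-- The inverse die map is the identity off the open unit disc as well. [folklore] -/
theorem die_symm_apply_of_one_le (θ θ' : D.K) {p : E²} (hp : 1 ≤ ‖p‖) :
    (D.die θ θ').symm p = p := by
  rw [Equiv.symm_apply_eq, D.die_apply_of_one_le θ θ' p hp]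

/-- Each die map sends the closed unit disc into itself. [folklore] -/
theorem mapsTo_die_closedBall (θ θ' : D.K) :
    MapsTo (D.die θ θ') (closedBall (0 : E²) 1) (closedBall 0 1) := by
  intro p hp
  rw [mem_closedBall_zero_iff] at hp ⊢
  by_contra h
  have h1 : 1 ≤ ‖D.die θ θ' p‖ := (not_le.mp h).le
  have hfix : D.die θ θ' (D.die θ θ' p) = D.die θ θ' p := D.die_apply_of_one_le θ θ' _ h1
  rw [(D.die θ θ').injective hfix] at h
  exact h hp

/-- Each inverse die map sends the closed unit disc into itself. [folklore] -/
theorem mapsTo_die_symm_closedBall (θ θ' : D.K) :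
    MapsTo (D.die θ θ').symm (closedBall (0 : E²) 1) (closedBall 0 1) := by
  intro p hp
  rw [mem_closedBall_zero_iff] at hp ⊢
  by_contra h
  have h1 : 1 ≤ ‖(D.die θ θ').symm p‖ := (not_le.mp h).le
  have hfix : D.die θ θ' ((D.die θ θ').symm p) = (D.die θ θ').symm p :=
    D.die_apply_of_one_le θ θ' _ h1
  rw [Equiv.apply_symm_apply] at hfix
  rw [← hfix] at h
  exact h hp

/-- Each die map is a bijection of the closed unit disc onto itself (the request's "bijection of
`Metric.closedBall 0 1` onto itself"). [folklore] -/
theorem bijOn_die_closedBall (θ θ' : D.K) :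
    BijOn (D.die θ θ') (closedBall (0 : E²) 1) (closedBall 0 1) :=
  (D.die θ θ').bijOn' (D.mapsTo_die_closedBall θ θ') (D.mapsTo_die_symm_closedBall θ θ')

/-- Each die map restricts to a bijection of the OPEN unit disc as well. [folklore] -/
theorem bijOn_die_ball (θ θ' : D.K) : BijOn (D.die θ θ') (ball (0 : E²) 1) (ball 0 1) := by
  have key : ∀ e : E² ≃ E², (∀ p : E², 1 ≤ ‖p‖ → e p = p) →
      MapsTo e (ball (0 : E²) 1) (ball 0 1) := by
    intro e he p hp
    rw [mem_ball_zero_iff] at hp ⊢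
    by_contra h
    have hfix := he (e p) (not_lt.mp h)
    rw [e.injective hfix] at h
    exact h hp
  refine (D.die θ θ').bijOn' (key _ (D.die_apply_of_one_le θ θ')) (key _ fun p hp => ?_)
  exact D.die_symm_apply_of_one_le θ θ' hp

/-! ### The law of the die and the non-degeneracy predicates -/

/-- The LAW OF THE DIE at `p`: the distribution of the outgoing Lambert point `F(θ, θ′)(p)` when the
two rotor states are independent with law `m` (push-forward of `m ⊗ m`). [folklore] -/
def dieLaw (p : E²) : Measure E² :=
  (D.m.prod D.m).map fun q : D.K × D.K => D.die q.1 q.2 p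

/-- Unfolding lemma for `dieLaw`. [folklore] -/
theorem dieLaw_eq (p : E²) :
    D.dieLaw p = (D.m.prod D.m).map (fun q : D.K × D.K => D.die q.1 q.2 p) := rfl

/-- The evaluation map `(θ, θ′) ↦ F(θ, θ′)(p)` is measurable. [folklore] -/
theorem measurable_die_eval (p : E²) : Measurable fun q : D.K × D.K => D.die q.1 q.2 p :=
  D.measurable_die.comp (measurable_fst.prodMk (measurable_snd.prodMk measurable_const))

/-- The law of the die is a probability measure. [folklore] -/
instance isProbabilityMeasure_dieLaw (p : E²) : IsProbabilityMeasure (D.dieLaw p) :=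
  Measure.isProbabilityMeasure_map (D.measurable_die_eval p).aemeasurable

/-- Off the open disc nothing is randomised: the law of the die at `p` with `‖p‖ ≥ 1` is the Dirac
mass at `p` (which is why the predicates below quantify over the open disc). [folklore] -/
theorem dieLaw_of_one_le {p : E²} (hp : 1 ≤ ‖p‖) : D.dieLaw p = Measure.dirac p := by
  have : (fun q : D.K × D.K => D.die q.1 q.2 p) = fun _ => p :=
    funext fun q => D.die_apply_of_one_le q.1 q.2 p hp
  rw [dieLaw, this, Measure.map_const, measure_univ, one_smul]

/-- **Absolutely continuous die law** (the satisfiable, one-sided half of FULL SUPPORT; what the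
one-sphere Hopf property consumes): for every `p` in the open unit disc the law of `F(·,·)(p)`
under `m ⊗ m` is absolutely continuous with respect to Lebesgue measure. [folklore] -/
def HasAbsolutelyContinuousLaw (D : AnosovDie) : Prop :=
  ∀ p ∈ ball (0 : E²) 1, D.dieLaw p ≪ volume

/-- **Full support** (verbatim form of the request): for every `p` in the open unit disc the law
of `F(·,·)(p)` under `m ⊗ m` and Lebesgue measure restricted to the closed unit disc are mutually
absolutely continuous.  WARNING (module docstring, item 7): unsatisfiable for dice jointly
continuous in `(θ, θ′, p)`; prefer `HasAbsolutelyContinuousLaw` or a local version. [folklore] -/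
def HasFullSupport (D : AnosovDie) : Prop :=
  ∀ p ∈ ball (0 : E²) 1, D.dieLaw p ≪ volume.restrict (closedBall (0 : E²) 1) ∧
    volume.restrict (closedBall (0 : E²) 1) ≪ D.dieLaw p

/-- Full support implies absolutely continuous die laws. [folklore] -/
theorem HasFullSupport.hasAbsolutelyContinuousLaw {D : AnosovDie} (h : D.HasFullSupport) :
    D.HasAbsolutelyContinuousLaw :=
  fun p hp => (h p hp).1.trans (Measure.absolutelyContinuous_of_le Measure.restrict_le_self)

/-- The trivial die `F ≡ id` (the ordinary hard-sphere gas) is NOT absolutely continuous: its law at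
`p` is `δ_p`.  (So `OneSphereHopfToMaxwellian`'s "any die, including `F ≡ id`" ranges over the bare
structure, while `RotorDiceHopf` must assume the predicates.) [folklore] -/
theorem not_hasAbsolutelyContinuousLaw_of_die_eq_refl
    (h : ∀ θ θ' : D.K, D.die θ θ' = Equiv.refl _) : ¬ D.HasAbsolutelyContinuousLaw := by
  intro hac
  have h0 : (0 : E²) ∈ ball (0 : E²) 1 := mem_ball_self one_pos
  have hlaw : D.dieLaw 0 = Measure.dirac 0 := by
    have : (fun q : D.K × D.K => D.die q.1 q.2 (0 : E²)) = fun _ => 0 := funext fun q => by simp [h]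
    rw [dieLaw, this, Measure.map_const, measure_univ, one_smul]
  have := hac 0 h0
  rw [hlaw] at this
  have hnull : (Measure.dirac (0 : E²)) {0} = 0 := this (measure_singleton 0)
  simp at hnull

/-- The PAIR-PLAQUE MAP at `(θ, θ′, p)`: `(r, r′) ↦ F(W θ r, W θ′ r′)(p)` — how the outgoing
Lambert point moves when both rotor states slide along their unstable plaques. [folklore] -/
def pairPlaqueMap (θ θ' : D.K) (p : E²) : ℝ × ℝ → E² :=
  fun r => D.die (D.plaque θ r.1) (D.plaque θ' r.2) p

/-- Unfolding lemma for `pairPlaqueMap`. [folklore] -/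
@[simp]
theorem pairPlaqueMap_apply (θ θ' : D.K) (p : E²) (r : ℝ × ℝ) :
    D.pairPlaqueMap θ θ' p r = D.die (D.plaque θ r.1) (D.plaque θ' r.2) p := rfl

/-- At the origin of the plaque parameters the pair-plaque map returns `F(θ, θ′)(p)`. [folklore] -/
theorem pairPlaqueMap_zero (θ θ' : D.K) (p : E²) : D.pairPlaqueMap θ θ' p 0 = D.die θ θ' p := by
  simp [pairPlaqueMap, D.plaque_zero]

/-- The pair-plaque map is `C^∞`. [folklore] -/
theorem contDiff_pairPlaqueMap (θ θ' : D.K) (p : E²) : ContDiff ℝ ∞ (D.pairPlaqueMap θ θ' p) := by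
  have h0 : ContDiff ℝ ∞ fun r : ℝ × ℝ => (r.1, r.2, p) :=
    contDiff_fst.prodMk (contDiff_snd.prodMk contDiff_const)
  exact ContDiff.comp (D.contDiff_die_plaque θ θ') h0

/-- **Pair-plaque submersivity**: for `m ⊗ m`-a.e. pair of rotor states `(θ, θ′)` and every `p` in
the open unit disc, the differential at `(0, 0)` of `(r, r′) ↦ F(W θ r, W θ′ r′)(p)` is onto `ℝ²`
(a single rotor reads only a curve, `dim E^u = 1 < 2`; the colliding PAIR reads an open set).
[folklore] -/
def IsPairPlaqueSubmersive (D : AnosovDie) : Prop :=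
  ∀ᵐ q ∂(D.m.prod D.m), ∀ p ∈ ball (0 : E²) 1,
    Surjective (fderiv ℝ (D.pairPlaqueMap q.1 q.2 p) 0)

/-- The trivial die is not pair-plaque submersive either (its pair-plaque maps are constant), as
soon as `m ⊗ m` is not the zero measure — which it never is. [folklore] -/
theorem not_isPairPlaqueSubmersive_of_die_eq_refl
    (h : ∀ θ θ' : D.K, D.die θ θ' = Equiv.refl _) : ¬ D.IsPairPlaqueSubmersive := by
  intro hsub
  have hconst : ∀ (q : D.K × D.K) (p : E²), D.pairPlaqueMap q.1 q.2 p = fun _ => p := by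
    intro q p; funext r; simp [pairPlaqueMap, h]
  have hfalse : ∀ᵐ q ∂(D.m.prod D.m), False := by
    filter_upwards [hsub] with q hq
    have h0 : (0 : E²) ∈ ball (0 : E²) 1 := mem_ball_self one_pos
    have hs := hq 0 h0
    rw [hconst q 0] at hs
    obtain ⟨v, hv⟩ := hs (EuclideanSpace.single 0 1)
    have : (EuclideanSpace.single (0 : Fin 2) (1 : ℝ)) 0 = 0 := by
      rw [← hv]; simp
    simp at this
  rw [Filter.eventually_false_iff_eq_bot, ae_eq_bot] at hfalse
  exact (IsProbabilityMeasure.ne_zero (D.m.prod D.m)) hfalse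

end AnosovDie

end Literature.Dynamics.Hyperbolic
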